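import Summits.BirchSwinnertonDyer.Rank1Residual.ManinAdditive.NeronOmegaThreeFrickeTrace
import Summits.BirchSwinnertonDyer.Rank1Residual.ManinAdditive.NeronConwayTw
import Summits.BirchSwinnertonDyer.Rank1Residual.ManinAdditive.KMIntersectionLP
import Summits.BirchSwinnertonDyer.Rank1Residual.ManinAdditive.NeronConwayR
import HarnessLib
import HarnessLib.Audit.Tags

/-!
TYPER HEADER (bsd-f2-manin-ty g16, 2026-08-29; T-imc-30) — imc g21 `HOME/imc/Sketch-imc-g21b.lean` sha16 1516d9245c11affc landed
VERBATIM (120 l.; farm rc 0 per imc, BC7 g21-bc7d CLEAN; re-checked by the typer) with TWO bookkeeping changes: (i) the namespace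
`…ManinAdditive.NeronOmegaTwoG21` is folded to the topic namespace `…ManinAdditive.NeronOmegaTwo` (the `p = 2` twin of
`NeronOmegaThree`; imc: cite decls as `NeronOmegaTwo.<name>`); (ii) §T below adds ONE named definition `omegaLatticeAtSixteen N`
spelling out imc's own sentence «DEFINITIONALLY: `Ω₂(N) = L_red ∩ EVEN ∩ ODD`» at `16 ∥ N` (asked for in T-imc-30; the general-`v₂`
`omegaLatticeAtTwo` with the `ζ₈` rows waits for imc's dictionary table and is NOT defined here), plus two `Iff.rfl`-level
unfolding lemmas.  APPEND (T-imc-31, 2026-08-29, §D below): the general-`v₂` dictionary — see the §D banner.  CONTENT: @[conjecture] candidate rows **E-imc-162 `OmegaEvenIffOddAtSixteen`**, **E-imc-163s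
`TraceQuarterIdentityAtTwo`** (support, routine coset identity — the `p = 2` twin of the PROVED `traceTranslateIdentityAtThree_holds`;
obligation node until proved), **E-imc-163 `OmegaEqFrickeTraceAtSixteen`**, **E-imc-164♭ `OmegaInductiveTraceAtSixteen`**; defs
`IsTwoAdicMem`, `EvenCondAtSixteen`, `OddCondAtSixteen`, `frickeTraceLatticeAtSixteen`.  Each row is an OBLIGATION NODE, nothing
asserted; census counts as stated by imc (ENGINE 7c j320767/j320781, ENGINE 7e j321173 28/28; MEMO-imc (27.10)–(27.13)); R-imc-64
PENDING.  HONEST FRAMING: E-blind lattice laws of the imc lens bearing on C2 `ManinOddAtFour` through the `p = 2` Ω-road; `2 ∤ c_E`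
is not proved by this; BSD is not proved by this; Manin's conjecture is not proved by this; C2 OPEN.
-/

/-!
# Sketch-imc-g21b (typed as `NeronOmegaTwo`) — the `p = 2` analogue: EVEN (trace) ⟺ ODD (twist) on the Katz–Mazur cusp lattice at `16 ∥ N` (E-imc-162/163)

LENS = Iwasawa-main-conjecture / integrality of families (cell `bsd-f2-manin`, seat `-imc` g21; MEMO-imc (27.10)–(27.12);
ENGINE 7c = HOME/imc/kit-g21/neronomega_split_g21.gp 685acb4bf285d318, kit j320767 (smoke) / j320781 (all `16 ∣ N ≤ 1024`)).

ALGEBRA (paper, definitional given the audited dictionary (D1)–(D5) of PROOFS-g19 §0).  At `16 ∥ N` the Katz–Mazur fibre of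
`X₀(N)` at `2` has ONE non-reduced component (`a = 2`, multiplicity `2`, cusps of type `1/4`, field `ℚ₂(i)`), whose
dualising-sheaf condition reads `π^{δ₂} · (t_{1/4} x)|w ∈ ℤ₂[i]⟦q⟧` with `π^{δ₂} = (1 − i)² ∼ 2`.  Since `{1, i}` is a
`ℤ₂`-basis of `ℤ₂[i]` and `2·t_{1/4} = R₄ + 2i·Tw` (`R₄ = t_{1/4} + t_{3/4}` = tree `ramanujanFour`, `Tw = ⊗χ₋₄` = tree
`twistOperatorAtTwo`), the condition SPLITS RATIONALLY and EXACTLY into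
  EVEN: `(R₄ x)|w` is `2`-integral   and   ODD: `2·(Tw x)|w` is `2`-integral,
and `(R₄ x)|W_N = Tr^N_{N/4}(x|W_N) − Tr^N_{N/2}(x|W_N)` (coset identity E-imc-163s below), so on the reduced-component lattice
`L_red = kmCuspLattice N` (tree, ConwayCut) EVEN ⟺ «the degeneracy trace of `x|W_N` to level `N/4` is `2`-integral».
Hence, DEFINITIONALLY: `Ω₂(N) = L_red ∩ EVEN ∩ ODD` (ENGINE 7c self-check c9 = 1 at every component of every level run).

FINDING (E-blind LAW E-imc-162, pre-registered question Q-g21-2; my prediction «ODD carries the cut, EVEN automatic» was WRONG):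
on `L_red` the two halves are EQUIVALENT — `L_red ∩ EVEN = L_red ∩ ODD = Ω₂(N)` — while each is a NON-trivial cut
(`ord₂[L_red : Ω₂] = 1, 1, 2, 2, 2` at `N = 176, 240, 368, 352, 448`; `≥ 1` at 25/31 levels `16 ∥ N ≤ 1008` by ENGINE 7).
Smoke j320767: 9/9 levels (`v₂(N) = 4, 5, 6`), 15/15 components, `o_k` constant in `k` (also on the `ζ₈`-component at `64 ∣ N`).
So at `16 ∥ N`:  **`Ω₂(N) = {x ∈ S₂ : x|w, Tr^N_{N/2}(x), Tr^N_{N/2}(x|W), Tr^N_{N/4}(x|W) all 2-integral}`** — the exact `p = 2`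
analogue of E-imc-160a («Ω = FRICKE-TRACE INTEGRALITY»), cyclotomic-free AND twist-free, with the twist law of `p = 3` replaced by
an even–odd EQUIVALENCE.  Not formal from the dictionary as far as I can see (Galois conjugation and the `w`-symmetry of the
self-partner component only give `A ± iB`).  Nearest tree statement: E-imc-137 `TwistRamanujanCoincidence` (the `2·Tw`- and
`R₄`-STABILITY defects of the Conway lattice `S^G` switch on at the same levels) — E-162 is the statement for CONDITION lattices
on `L_red`, an equality not a coincidence of supports, and it identifies both with `Ω₂`.
PARTITION (imc): bears on C2 `ManinOddAtFour` through the `p = 2` Ω-road (Λ₂ ⊆ Ω₂; = at rational-singularity levels) ·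
beyond-print theorem: no · BSD is not proved by this.
-/

open scoped MatrixGroups ModularForm
open CongruenceSubgroup Literature.NumberTheory.EllipticCurves.ModularForms
open Summit.BirchSwinnertonDyer.Rank1Residual.ManinAdditive
open Summit.BirchSwinnertonDyer.Rank1Residual.ManinAdditive.ConwayCut
open Summit.BirchSwinnertonDyer.Rank1Residual.ManinAdditive.NeronConway
open Summit.BirchSwinnertonDyer.Rank1Residual.ManinAdditive.NeronConwayTw
open Summit.BirchSwinnertonDyer.Rank1Residual.ManinAdditive.KMIntersectionLP
open Summit.BirchSwinnertonDyer.Rank1Residual.ManinAdditive.NeronConwayR (eighthTranslateGL ramanujanEight)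

noncomputable section

namespace Summit.BirchSwinnertonDyer.Rank1Residual.ManinAdditive.NeronOmegaTwo

/-- `2`-adic membership in a lattice (prime-to-`2` multiples allowed), as `IsThreeAdicMem` with `3 ↦ 2`. -/
def IsTwoAdicMem {N : ℕ} (Λ : Submodule ℤ (CuspForm (Gamma0 N) 2)) (y : CuspForm (Gamma0 N) 2) : Prop :=
  ∃ m : ℕ, ¬ 2 ∣ m ∧ (m : ℂ) • y ∈ Λ

/-- EVEN half of the multiplicity-2 component condition at `16 ∥ N`: `(R₄ x)|w_{16}` is `2`-integral
(ENGINE 7c word `W*R_0`, `k = 0` part). -/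
def EvenCondAtSixteen (N : ℕ) [NeZero N] (x : CuspForm (Gamma0 N) 2) : Prop :=
  IsPrimeToIntegral N 2 (atkinLehnerInvolutionAt N 2 2 (ramanujanFour N 2 x))

/-- ODD half: `2·(x ⊗ χ₋₄)|w_{16}` is `2`-integral (ENGINE 7c word `W*R_1`, `k = 1` part; «TWIST condition at 2»). -/
def OddCondAtSixteen (N : ℕ) [NeZero N] (x : CuspForm (Gamma0 N) 2) : Prop :=
  IsPrimeToIntegral N 2 ((2 : ℂ) • atkinLehnerInvolutionAt N 2 2 (twistOperatorAtTwo N 2 x))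

/-- **E-imc-162 `OmegaEvenIffOddAtSixteen`** (LAW candidate, E-blind, decidable level by level; imc g21, MEMO-imc (27.11)):
for `16 ∥ N` and `x` `2`-adically in the Katz–Mazur cusp lattice `L_red = kmCuspLattice N`, the EVEN and ODD halves of the
dualising-sheaf condition on the multiplicity-2 component are EQUIVALENT.  BC5: ENGINE 7c smoke j320767 (5 levels `16 ∥ N`:
48, 80, 176, 240, 368 — `LOMeqLredcapEVEN = LOMeqLredcapODD = 1`, cuts of `2`-order 0, 0, 1, 1, 2) + full run j320781
(all `16 ∣ N ≤ 1024`; pre-registered P-g21-8′).  Why it might fail: a level `16 ∥ N` where the `R₄`-defect and the twist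
defect of `L_red` differ (none ≤ 368; E-imc-137 found none for `S^G` ≤ 400).
TYPER FRAMING (E-imc-162): lens imc; LAW (ENGINE 7c census), nothing asserted. [conjecture — cell candidate, NOT a tree fact] -/
@[conjecture] def OmegaEvenIffOddAtSixteen : Prop :=
  ∀ (N : ℕ) [NeZero N], 16 ∣ N → ¬ 32 ∣ N →
    ∀ x : CuspForm (Gamma0 N) 2, IsTwoAdicMem (kmCuspLattice N) x →
      (EvenCondAtSixteen N x ↔ OddCondAtSixteen N x)

/-- **E-imc-163s `TraceQuarterIdentityAtTwo`** (SUPPORT, routine coset identity; the `p = 2` twin of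
`NeronOmegaThree.TraceTranslateIdentityAtThree`): for `N = 4M` with `4 ∣ M`, the degeneracy trace to level `M` composed with
the inclusion back is `y ↦ y + W t_{1/2} W y + W R₄ W y` (`Γ₀(M) = ⊔_{j<4} Γ₀(N)·(1 0; jM 1)` and
`(1 0; jM 1) = W_N (1 −j/4; 0 1) W_N⁻¹` up to the scalar `−N`).
TYPER FRAMING (E-imc-163s): lens imc; SUPPORT identity (paper-routine), obligation node until proved, nothing asserted. [conjecture — cell candidate, NOT a tree fact] -/
@[conjecture] def TraceQuarterIdentityAtTwo : Prop :=
  ∀ (M : ℕ) [NeZero M], 4 ∣ M → ∀ y : CuspForm (Gamma0 (4 * M)) 2,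
    degeneracyMap0 M (4 * M) 1 2 (adjDegeneracyMap0 (4 * M) M 1 2 y)
      = y + frickeInvolution (4 * M) 2 (halfTranslate (4 * M) 2 (frickeInvolution (4 * M) 2 y))
          + frickeInvolution (4 * M) 2 (ramanujanFour (4 * M) 2 (frickeInvolution (4 * M) 2 y))

/-- The «Fricke-trace lattice at 16»: `x ∈ S₂` `2`-adically with `x|w`, `Tr^N_M(x)`, `Tr^N_M(x|W_N)` (`M = N/2`) and
`Tr^N_{M'}(x|W_N)` (`M' = N/4`) all `2`-integral — four rational conditions, no cyclotomic arithmetic, no twist. -/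
def frickeTraceLatticeAtSixteen (N M M' : ℕ) [NeZero N] [NeZero M] [NeZero M'] : Submodule ℤ (CuspForm (Gamma0 N) 2) :=
  sSup {L : Submodule ℤ (CuspForm (Gamma0 N) 2) | L ≤ integralCuspForms0 N 2 ∧ ∀ x ∈ L,
    IsPrimeToIntegral N 2 (atkinLehnerInvolutionAt N 2 2 x) ∧
    IsPrimeToIntegral M 2 (adjDegeneracyMap0 N M 1 2 x) ∧
    IsPrimeToIntegral M 2 (adjDegeneracyMap0 N M 1 2 (frickeInvolution N 2 x)) ∧
    IsPrimeToIntegral M' 2 (adjDegeneracyMap0 N M' 1 2 (frickeInvolution N 2 x))}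

/-- **E-imc-163 `OmegaEqFrickeTraceAtSixteen`** (LAW candidate, E-blind; the `p = 2` twin of E-imc-160a): at `N = 16K`, `K` odd,
the lattice `L_red ∩ EVEN` (= `Ω₂(N)` definitionally, = `L_red ∩ ODD` by E-162) is the Fricke-trace lattice:
`2`-adically, `x ∈ kmCuspLattice N ∧ EvenCondAtSixteen N x ⟺ x ∈ frickeTraceLatticeAtSixteen N (8K) (4K)`.
Content beyond E-163s: the (AL) exchange `w_{16} ↔ W_N` on `2`-integrality along a fixed component (dictionary (D3)).
Why it might fail: only through (D3)/(AL) or a slip in E-163s.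
TYPER FRAMING (E-imc-163): lens imc; LAW, nothing asserted. [conjecture — cell candidate, NOT a tree fact] -/
@[conjecture] def OmegaEqFrickeTraceAtSixteen : Prop :=
  ∀ (K : ℕ) [NeZero K], ¬ 2 ∣ K →
    ∀ x : CuspForm (Gamma0 (16 * K)) 2,
      (IsTwoAdicMem (kmCuspLattice (16 * K)) x ∧ EvenCondAtSixteen (16 * K) x) ↔
        IsTwoAdicMem (frickeTraceLatticeAtSixteen (16 * K) (8 * K) (4 * K)) x

/-- **E-imc-164♭ `OmegaInductiveTraceAtSixteen`** (LAW candidate, E-blind; the `16 ∥ N`, Ω-free instance of the INDUCTIVE TRACE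
CRITERION E-imc-164 «`Ω_p(N) = {x ∈ L_red(N) : Tr^N_{N/p}(x), Tr^N_{N/p}(x|W_N) ∈ Ω_p(N/p)}`», uniform in `p ∈ {2,3}` and `v_p(N) ≥ 2`;
at `p = 3` it is the E-imc-156 family (ENGINE 8, 93/93 levels), at `p = 2` it is ENGINE 7e (HOME/imc/kit-g21/neronomega_itc_g21.gp
e54054ee95df7f05, kit j321173: 28/28 levels `16 ∣ N ≤ 576`, `v₂ = 4,5,6,7`, cuts up to `2³`, print direction `Ω ⊆ ITC` 28/28)):
for `N = 16K`, `K` odd, and `x` `2`-adically in `kmCuspLattice N` (= `L_red`; at level `8K` the same four-word lattice IS `Ω₂(8K)`, all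
components being reduced), the EVEN condition (= membership in `Ω₂(N)` by E-162) holds iff BOTH degeneracy traces `Tr^N_{8K}(x)` and
`Tr^N_{8K}(x|W_N)` lie `2`-adically in `kmCuspLattice (8K)`.  Why it might fail: a level where one-storey Ω-valued traces do not see the
`ζ₄`-component (none ≤ 576; N = 352 shows a single trace is not enough).
TYPER FRAMING (E-imc-164♭): lens imc; LAW (ENGINE 7e 28/28), nothing asserted. [conjecture — cell candidate, NOT a tree fact] -/
@[conjecture] def OmegaInductiveTraceAtSixteen : Prop :=
  ∀ (K : ℕ) [NeZero K], ¬ 2 ∣ K →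
    ∀ x : CuspForm (Gamma0 (16 * K)) 2, IsTwoAdicMem (kmCuspLattice (16 * K)) x →
      (EvenCondAtSixteen (16 * K) x ↔
        (IsTwoAdicMem (kmCuspLattice (8 * K)) (adjDegeneracyMap0 (16 * K) (8 * K) 1 2 x) ∧
         IsTwoAdicMem (kmCuspLattice (8 * K)) (adjDegeneracyMap0 (16 * K) (8 * K) 1 2 (frickeInvolution (16 * K) 2 x))))

/-! ### §T (typer, T-imc-30) `Ω₂(N)` at `16 ∥ N`, named -/

/-- **`Ω₂(N)` at `16 ∥ N`** — imc (Sketch-imc-g21b header): «DEFINITIONALLY: `Ω₂(N) = L_red ∩ EVEN ∩ ODD`», i.e. the largest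
sub-`ℤ`-module of the Katz–Mazur cusp lattice `L_red = kmCuspLattice N` all of whose elements satisfy the EVEN and the ODD half of
the dualising-sheaf condition on the multiplicity-2 component (ENGINE 7c self-check c9 = 1).  Named here so that imc's general-`v₂`
inductive trace criterion can refer to the `v₂ = 4` storey; it is NOT claimed to be the right object when `32 ∣ N`. -/
def omegaLatticeAtSixteen (N : ℕ) [NeZero N] : Submodule ℤ (CuspForm (Gamma0 N) 2) :=
  sSup {L : Submodule ℤ (CuspForm (Gamma0 N) 2) | L ≤ kmCuspLattice N ∧ ∀ x ∈ L,
    EvenCondAtSixteen N x ∧ OddCondAtSixteen N x}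

/-- `Ω₂(N) ≤ L_red` at `16 ∥ N`. -/
theorem omegaLatticeAtSixteen_le (N : ℕ) [NeZero N] : omegaLatticeAtSixteen N ≤ kmCuspLattice N :=
  sSup_le fun _ hL => hL.1

/-- A lattice inside `L_red` on which EVEN and ODD hold lies in `Ω₂(N)`. -/
theorem le_omegaLatticeAtSixteen (N : ℕ) [NeZero N] {L : Submodule ℤ (CuspForm (Gamma0 N) 2)}
    (hL : L ≤ kmCuspLattice N) (h : ∀ x ∈ L, EvenCondAtSixteen N x ∧ OddCondAtSixteen N x) :
    L ≤ omegaLatticeAtSixteen N :=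
  le_sSup ⟨hL, h⟩

/-! ### §D (typer APPEND, T-imc-31, 2026-08-29) — imc's `p = 2` DICTIONARY for general `v = v₂(N)` (HOME/imc/DICTIONARY-p2-g21.md
sha16 c90e89723a1c0eb0; authority ENGINE 7/7c/7e `neronomega_itc_g21.gp` e54054ee95df7f05 ll. 2036–2046, dictionary (D1)–(D5) of
PROOFS-g19 §0, ref1 R78/R79).  Rows `a = 0 … v`, `b = min(a, v − a)`, `y = x` if `a ≤ v − a` else `y = W x`, field `ℚ₂(ζ_{2^b})`,
allowance `π^{δ(b)}`, `δ(b) = 2^{b−1}(b−1)`; RATIONAL SPLITTING (ENGINE 7c self-check c9 = 1 at 103/103 components): `b = 2`: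
EVEN ∧ ODD; `b = 3`: the four conditions `W R₈^{(c)} y ∈ ℤ₂⟦q⟧`, `c = 0,1,2,3`, `R₈^{(c)} = Σ_{j odd} ζ₈^{−jc} t_{j/8}`
(`= 4(P_c − P_{c+4})`, rational); `b = 4` rows (`v ≥ 8`) are NOT typed (ENGINE-unsupported) and the laws below carry
`¬ 256 ∣ N`.  Typed VERBATIM from the dictionary's «What to type»; the names are the typer's.  Nothing asserted. -/

/-- `ζ₈ = e^{2πi/8}`. -/
def zeta8 : ℂ := Complex.exp (2 * Real.pi * Complex.I / 8)

/-- The translation `t_{j/8} : f ↦ f(z + j/8)` on `S_k(Γ₀(N))`, `64 ∣ N`, normalised like `quarterTranslate`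
(`64^{1−k/2}` times the double-coset operator of `NeronConwayR.eighthTranslateGL j`; a single coset when `64 ∣ N`); on
`q`-expansions `aₙ ↦ ζ₈^{jn} aₙ` (p2: `cuspCoeff_eighthTranslate_two`).  Junk if `64 ∤ N`. -/
def eighthTranslate (N : ℕ) [NeZero N] (k : ℤ) (j : ℕ) : CuspForm (Gamma0 N) k →ₗ[ℂ] CuspForm (Gamma0 N) k :=
  (((64 : ℝ) ^ (1 - (k : ℝ) / 2) : ℝ) : ℂ) • cuspHeckeOperatorₗ (Gamma0 N) k (eighthTranslateGL j)

/-- imc's **`R₈^{(c)} := Σ_{j ∈ {1,3,5,7}} ζ₈^{−jc} t_{j/8}`** (DICTIONARY row `b = 3`): on `q`-expansions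
`aₙ ↦ 4(𝟙[n ≡ c (8)] − 𝟙[n ≡ c + 4 (8)]) aₙ`, hence `ℚ`-RATIONAL; `R₈^{(0)} = R₈` (`ramanujanEightChar_zero`),
`R₈^{(1)} x = 2(x ⊗ χ₈ + x ⊗ χ₋₈)`, `R₈^{(3)} x = 2(x ⊗ χ₋₈ − x ⊗ χ₈)`; and `4 t_{1/8} = Σ_{c<4} ζ₈^c R₈^{(c)}`. -/
def ramanujanEightChar (N : ℕ) [NeZero N] (k : ℤ) (c : ℕ) : CuspForm (Gamma0 N) k →ₗ[ℂ] CuspForm (Gamma0 N) k :=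
  (zeta8⁻¹) ^ (1 * c) • eighthTranslate N k 1 + (zeta8⁻¹) ^ (3 * c) • eighthTranslate N k 3 +
    (zeta8⁻¹) ^ (5 * c) • eighthTranslate N k 5 + (zeta8⁻¹) ^ (7 * c) • eighthTranslate N k 7

/-- `R₈^{(0)} = R₈` (`NeronConwayR.ramanujanEight`, same normalisation). -/
theorem ramanujanEightChar_zero (N : ℕ) [NeZero N] (k : ℤ) : ramanujanEightChar N k 0 = ramanujanEight N k := by
  simp only [ramanujanEightChar, ramanujanEight, eighthTranslate, mul_zero, pow_zero, one_smul, smul_add]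


/-- The **reduced part** `L_red^{gen}(N)` of the dictionary (rows with `b ≤ 1`, all REDUCED components), `2`-adically:
the largest sub-`ℤ`-module of `S₂(Γ₀(N); ℤ)` with `W x`, (`4 ∣ N`:) `W t_{1/2} x`, (`8 ∣ N`:) `W t_{1/2} W x` all `2`-adically
integral.  (imc: equals the four-word lattice `1, W, W t, W t W` = `ConwayCut.kmCuspLattice N` at `8 ∥ N` and `16 ∥ N` up to the
`2`-adic convention — NOT asserted here.) -/
def kmCuspLatticeGen (N : ℕ) [NeZero N] : Submodule ℤ (CuspForm (Gamma0 N) 2) :=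
  sSup {L : Submodule ℤ (CuspForm (Gamma0 N) 2) | L ≤ integralCuspForms0 N 2 ∧ ∀ x ∈ L,
    IsPrimeToIntegral N 2 (atkinLehnerInvolutionAt N 2 2 x) ∧
    (4 ∣ N → IsPrimeToIntegral N 2 (atkinLehnerInvolutionAt N 2 2 (halfTranslate N 2 x))) ∧
    (8 ∣ N → IsPrimeToIntegral N 2 (atkinLehnerInvolutionAt N 2 2 (halfTranslate N 2 (atkinLehnerInvolutionAt N 2 2 x))))}

/-- **`Ω₂(N)` for general `v = v₂(N) ≤ 7`** (imc DICTIONARY p = 2): the largest sub-`ℤ`-module of `S₂(Γ₀(N); ℤ)` whose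
elements satisfy, `2`-adically and in RATIONAL form, the rows
 `a = 0` (`b = 0`): `W x`;  `a = 1` (`b = 1`, `4 ∣ N`): `W t x`;  `a = v−1` (`b = 1`, `8 ∣ N`): `W t W x`;
 `a = 2` (`b = 2`, `16 ∣ N`): EVEN(x) ∧ ODD(x);  `a = v−2` (`b = 2`, `32 ∣ N`): EVEN(W x) ∧ ODD(W x);
 `a = 3` (`b = 3`, `64 ∣ N`): `W R₈^{(c)} x`, `c < 4`;  `a = v−3` (`b = 3`, `128 ∣ N`): `W R₈^{(c)} (W x)`, `c < 4`;
 `a = v`: `x` integral (ambient).  The `b = 4` rows (`256 ∣ N`) are deliberately ABSENT: for `256 ∣ N` this is NOT imc's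
`Ω₂(N)` and no law below uses it there. -/
def omegaLatticeAtTwo (N : ℕ) [NeZero N] : Submodule ℤ (CuspForm (Gamma0 N) 2) :=
  sSup {L : Submodule ℤ (CuspForm (Gamma0 N) 2) | L ≤ integralCuspForms0 N 2 ∧ ∀ x ∈ L,
    IsPrimeToIntegral N 2 (atkinLehnerInvolutionAt N 2 2 x) ∧
    (4 ∣ N → IsPrimeToIntegral N 2 (atkinLehnerInvolutionAt N 2 2 (halfTranslate N 2 x))) ∧
    (8 ∣ N → IsPrimeToIntegral N 2
      (atkinLehnerInvolutionAt N 2 2 (halfTranslate N 2 (atkinLehnerInvolutionAt N 2 2 x)))) ∧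
    (16 ∣ N → EvenCondAtSixteen N x ∧ OddCondAtSixteen N x) ∧
    (32 ∣ N → EvenCondAtSixteen N (atkinLehnerInvolutionAt N 2 2 x) ∧ OddCondAtSixteen N (atkinLehnerInvolutionAt N 2 2 x)) ∧
    (64 ∣ N → ∀ c : Fin 4, IsPrimeToIntegral N 2 (atkinLehnerInvolutionAt N 2 2 (ramanujanEightChar N 2 c x))) ∧
    (128 ∣ N → ∀ c : Fin 4, IsPrimeToIntegral N 2
      (atkinLehnerInvolutionAt N 2 2 (ramanujanEightChar N 2 c (atkinLehnerInvolutionAt N 2 2 x))))}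

/-- `Ω₂(N) ≤ S₂(Γ₀(N); ℤ)`. -/
theorem omegaLatticeAtTwo_le_integral (N : ℕ) [NeZero N] : omegaLatticeAtTwo N ≤ integralCuspForms0 N 2 :=
  sSup_le fun _ hL => hL.1

/-- `Ω₂(N) ≤ L_red^{gen}(N)` (the reduced rows are among the rows). -/
theorem omegaLatticeAtTwo_le_kmCuspLatticeGen (N : ℕ) [NeZero N] : omegaLatticeAtTwo N ≤ kmCuspLatticeGen N :=
  sSup_le fun _ hL => le_sSup ⟨hL.1, fun x hx => ⟨(hL.2 x hx).1, (hL.2 x hx).2.1, (hL.2 x hx).2.2.1⟩⟩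

/-- A lattice of integral forms satisfying all the rows lies in `Ω₂(N)`. -/
theorem le_omegaLatticeAtTwo (N : ℕ) [NeZero N] {L : Submodule ℤ (CuspForm (Gamma0 N) 2)}
    (hL : L ≤ integralCuspForms0 N 2)
    (h : ∀ x ∈ L, IsPrimeToIntegral N 2 (atkinLehnerInvolutionAt N 2 2 x) ∧
      (4 ∣ N → IsPrimeToIntegral N 2 (atkinLehnerInvolutionAt N 2 2 (halfTranslate N 2 x))) ∧
      (8 ∣ N → IsPrimeToIntegral N 2
        (atkinLehnerInvolutionAt N 2 2 (halfTranslate N 2 (atkinLehnerInvolutionAt N 2 2 x)))) ∧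
      (16 ∣ N → EvenCondAtSixteen N x ∧ OddCondAtSixteen N x) ∧
      (32 ∣ N → EvenCondAtSixteen N (atkinLehnerInvolutionAt N 2 2 x) ∧
        OddCondAtSixteen N (atkinLehnerInvolutionAt N 2 2 x)) ∧
      (64 ∣ N → ∀ c : Fin 4, IsPrimeToIntegral N 2 (atkinLehnerInvolutionAt N 2 2 (ramanujanEightChar N 2 c x))) ∧
      (128 ∣ N → ∀ c : Fin 4, IsPrimeToIntegral N 2
        (atkinLehnerInvolutionAt N 2 2 (ramanujanEightChar N 2 c (atkinLehnerInvolutionAt N 2 2 x))))) :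
    L ≤ omegaLatticeAtTwo N :=
  le_sSup ⟨hL, h⟩

/-- **E-imc-164 `OmegaInductiveTraceAtTwo`** — the INDUCTIVE TRACE CRITERION at `p = 2`, general `v` (imc g21 ADDENDUM-2, MEMO-imc
(27.13), DICTIONARY-p2-g21.md): «`Ω₂(N) = {x ∈ L_red(N) : Tr^N_{N/2}(x), Tr^N_{N/2}(x|W_N) ∈ Ω₂(N/2)}`» `2`-adically, for
`16 ∣ N`, `¬ 256 ∣ N` (stated with `N = 2M`, `8 ∣ M`, `¬ 128 ∣ M`).  BC5: ENGINE 7e (`neronomega_itc_g21.gp` e54054ee95df7f05) kit j321173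
28/28 levels `16 ∣ N ≤ 576` (`v₂ = 4,5,6,7`, cuts up to `2³`, print direction `Ω ⊆ ITC` 28/28; both traces needed at N = 352,
608, 640, 704), j321324 (`544 … 1008`) running.  Why it might fail: a level where the one-storey Ω-valued traces miss a
`ζ₈`/`ζ₄`-storey condition (none in 42 levels ≤ 1008 so far).
TYPER FRAMING (E-imc-164): lens imc; LAW (ENGINE 7e census), nothing asserted. [conjecture — cell candidate, NOT a tree fact] -/
@[conjecture] def OmegaInductiveTraceAtTwo : Prop :=
  ∀ (M : ℕ) [NeZero M], 8 ∣ M → ¬ 128 ∣ M →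
    ∀ x : CuspForm (Gamma0 (2 * M)) 2,
      IsTwoAdicMem (omegaLatticeAtTwo (2 * M)) x ↔
        (IsTwoAdicMem (kmCuspLatticeGen (2 * M)) x ∧
         IsTwoAdicMem (omegaLatticeAtTwo M) (adjDegeneracyMap0 (2 * M) M 1 2 x) ∧
         IsTwoAdicMem (omegaLatticeAtTwo M) (adjDegeneracyMap0 (2 * M) M 1 2 (frickeInvolution (2 * M) 2 x)))

/-- **E-imc-162gen `OmegaComponentPartsEquivalent`** (optional general-`v` form of E-imc-162; imc DICTIONARY: «on `kmCuspLatticeGen N`, for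
each non-reduced row ALL its rational parts are equivalent — `o_k` constant at 103/103 components of j320781 incl. the 16
`ζ₈`-components»): for `16 ∣ N`, `¬ 256 ∣ N` and `x` `2`-adically in `L_red^{gen}(N)`: EVEN(x) ⟺ ODD(x); at `32 ∣ N` also
EVEN(Wx) ⟺ ODD(Wx); at `64 ∣ N` the four `R₈^{(c)}`-conditions on `x` are pairwise equivalent; at `128 ∣ N` likewise on `W x`.
Why it might fail: as E-imc-162 (a level where the parts of one row differ; none ≤ 1008).
TYPER FRAMING (E-imc-162gen): lens imc; LAW (ENGINE 7c census 103/103), nothing asserted. [conjecture — cell candidate, NOT a tree fact] -/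
@[conjecture] def OmegaComponentPartsEquivalent : Prop :=
  ∀ (N : ℕ) [NeZero N], 16 ∣ N → ¬ 256 ∣ N →
    ∀ x : CuspForm (Gamma0 N) 2, IsTwoAdicMem (kmCuspLatticeGen N) x →
      (EvenCondAtSixteen N x ↔ OddCondAtSixteen N x) ∧
      (32 ∣ N → (EvenCondAtSixteen N (atkinLehnerInvolutionAt N 2 2 x) ↔
        OddCondAtSixteen N (atkinLehnerInvolutionAt N 2 2 x))) ∧
      (64 ∣ N → ∀ c c' : Fin 4,
        (IsPrimeToIntegral N 2 (atkinLehnerInvolutionAt N 2 2 (ramanujanEightChar N 2 c x)) ↔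
          IsPrimeToIntegral N 2 (atkinLehnerInvolutionAt N 2 2 (ramanujanEightChar N 2 c' x)))) ∧
      (128 ∣ N → ∀ c c' : Fin 4,
        (IsPrimeToIntegral N 2 (atkinLehnerInvolutionAt N 2 2 (ramanujanEightChar N 2 c (atkinLehnerInvolutionAt N 2 2 x))) ↔
          IsPrimeToIntegral N 2 (atkinLehnerInvolutionAt N 2 2 (ramanujanEightChar N 2 c' (atkinLehnerInvolutionAt N 2 2 x)))))

/-- Bookkeeping edge: the general criterion at `v = 4` has the SHAPE of E-imc-164♭ once `Ω₂(8K) = L_red(8K)` and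
`Ω₂(16K) = L_red(16K) ∩ EVEN ∩ ODD` are fed in; here only the trivial projection «E-164 at `M = 8K`» is recorded. -/
theorem omegaInductiveTraceAtTwo_sixteen (h : OmegaInductiveTraceAtTwo) (K : ℕ) [NeZero K] (hK : ¬ 2 ∣ K)
    (x : CuspForm (Gamma0 (2 * (8 * K))) 2) :
    IsTwoAdicMem (omegaLatticeAtTwo (2 * (8 * K))) x ↔
      (IsTwoAdicMem (kmCuspLatticeGen (2 * (8 * K))) x ∧
       IsTwoAdicMem (omegaLatticeAtTwo (8 * K)) (adjDegeneracyMap0 (2 * (8 * K)) (8 * K) 1 2 x) ∧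
       IsTwoAdicMem (omegaLatticeAtTwo (8 * K))
         (adjDegeneracyMap0 (2 * (8 * K)) (8 * K) 1 2 (frickeInvolution (2 * (8 * K)) 2 x))) :=
  h (8 * K) (dvd_mul_right 8 K) (fun h128 => hK (by
    have : (128 : ℕ) = 8 * 16 := by norm_num
    rw [this] at h128
    exact (show (2 : ℕ) ∣ 16 by norm_num).trans (Nat.dvd_of_mul_dvd_mul_left (by norm_num) h128))) x

end Summit.BirchSwinnertonDyer.Rank1Residual.ManinAdditive.NeronOmegaTwo

end
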